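import Literature.NumberTheory.EllipticCurves.YanZhu2026.GreenbergMainTheoremsAnyRoot
import HarnessLib

/-!
# X. Wan, *Iwasawa main conjecture for Rankin–Selberg `p`-adic `L`-functions*, Algebra & Number Theory
# **14**:2 (2020) 383–483 — §1 Theorems 1.1 and 1.2 (the three- and two-variable Greenberg divisibilities
# `(𝓛) ⊇ char(X)` for `f ⊗ (CM family of higher weight)`), §2.2 (the Selmer group `X_{f,𝒦,ξ}`), §7.5
# Prop. 7.7 / Def. 7.8 (the `p`-adic `L`-functions and the anticyclotomic restriction of Hida's `𝓛`):
# VERBATIM print, and ONE named fact — Theorem 1.2 read on an elliptic curve (D-0014, statement only)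

Typed by the literature seat `bsd-addord-ty-wan1` (cell `pub/bsd-addord`, director-bsd g17 (357)(3); brief:
`Cruxes/GordTwoRankZeroOffCaseOne/LeadReport12.md` §4 and `FlatInclusionTypingSpec.md` §2–§3 of the cruxes
stmt-BirchSwinnertonDyer-19357/19358/19359). Nothing is asserted about any curve; no `_holds`; no new
notion (EXISTING two-variable vocabulary only: `WeierstrassCurve.XGr₂`, `IwasawaAlgebra₂.toUnr₂`,
`IsKatzMeasure₂`, `IsGreenbergLFunctionAnyRoot₂`). BSD is proved for no curve by any of this.

## Source of record, versions and numbering (READ FIRST)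

The ACCEPTED manuscript is arXiv:1408.4044**v5** (2019-09-15, "101 pages, to appear in Algebra and Number
Theory"; TeX `final_paper2.tex`, fetched by this seat, 2849 lines) = the published text (ANT 14 (2020)
383–483, doi 10.2140/ant.2020.14.383; bib key `Wan2020RankinSelbergIMC`; the publisher PDF is paywalled —
only a 3-page preview was readable — so locators below are §/Theorem numbers of print, which equal those
of v5 (`\newtheorem{theorem}[section]`), plus v5 TeX line numbers). The store text
`paper:arxiv-1408.4044` is arXiv **v1** (2014), whose single "Theorem 1.1" has parts (1) and (2): v1
Thm. 1.1 (1) = print **Theorem 1.1** (three variables, Hida family), v1 Thm. 1.1 (2) = print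
**Theorem 1.2** (two variables, one form). The cell's LeadReport12 §4 ("Wan 2020 Thm 1.1 (RATIONAL form
(2)/JSW Thm 6.1.3)") therefore means PRINT THEOREM 1.2, typed below; print Theorem 1.1 is quoted, not
typed (no `𝕀`-adic Hida-family objects in the tree — see "NOT typed"). v1 → print changes that matter:
"`κ ≡ 0 (mod p−1)`" became "`κ ≡ 0 (mod 2(p−1))`", "`2` splits in `𝒦`" was DROPPED, the local root-number
/conductor clause of (1) became (f)+(g), and (2)'s "`q ∣ N`" became "`q ∥ N`".

## The printed statements (ANT 14 (2020); v5 TeX line numbers)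

SETTING (§1, l.58): "Let `𝒦 ⊂ ℂ` be an imaginary quadratic field such that `p` splits in `𝒦` as
`(p) = v₀v̄₀`. We fix an isomorphism `ι : ℂ_p ≃ ℂ` and suppose `v₀` is determined by `ι`. There is a unique
`ℤ_p²`-extension `𝒦_∞/𝒦` unramified outside `p`. Let `Γ_𝒦 := Gal(𝒦_∞/𝒦)`. Suppose `𝐟` is a Hida family of
ordinary cuspidal eigenforms new outside `p` with coefficient ring `𝕀`, a normal finite extension of …
`ℤ_p[[W]]` … Suppose `ξ` is an `L`-valued Hecke character of `𝔸_𝒦^×/𝒦^×` whose infinity type is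
`(κ/2, −κ/2)` for some even integer `κ ≥ 6` and such that `ord_{v₀}(cond(ξ_{v₀})) ≤ 1` and
`ord_{v̄₀}(cond(ξ_{v̄₀})) ≤ 1`" [← THE TAME-CHARACTER SLOT: `ξ` may be tamely ramified at both primes above
`p`]. "… `𝓛_{𝐟,ξ,𝒦}^Σ ∈ 𝕀̂^{ur}[[Γ_𝒦]]`, `𝓛_{f,ξ,𝒦}^Σ ∈ 𝒪̂_L^{ur}[[Γ_𝒦]]`, interpolating the algebraic parts of
the special `L`-values `L_𝒦(f_φ, ξ_φ, κ/2)`, where … (`f_φ` has weight `2` and `ξ_φ` has infinity type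
`(κ/2, −κ/2)`) … We let `𝓛_{f₀,ξ,𝒦}` be the specialization of `𝓛_{𝐟,ξ,𝒦}` to a single form `f₀` of weight 2
and trivial character in the family `𝐟` … We also associate with `f = f₀`, `𝒦`, `ξ` a dual Selmer group
`X_{f,𝒦,ξ}` over `𝒪̂^{ur}_L[[Γ_𝒦]]`." (l.60). "We write `ε` for the cyclotomic character and `ω` for the
Teichmüller character of `G_ℚ`" (l.62); (irred)/(dist) for a `p`-nearly-ordinary eigenform `g` (l.63–70).

**Theorem 1.1** (l.74–89, VERBATIM). "Let `𝐟` be a Hida family of ordinary eigenforms that are new outside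
`p` of square-free tame level `N`, and suppose `𝐟` has a weight two specialization `f` that has trivial
nebentypus and is the ordinary stabilization of a new form of level `N`. Let `ρ̄` be the mod `p` residual
`G_ℚ`-representation associated with the Hida family `𝐟`. Let `ξ` be a Hecke character of `𝒦^×\𝔸_𝒦^×`
with infinity type `(κ/2, −κ/2)` for some `κ ≥ 6`. If (a) `p ≥ 5`; (b) `ξ|_{𝔸_ℚ^×} = ω ∘ Nm` and
`κ ≡ 0 (mod 2(p−1))`; (c) `ρ̄_𝐟|_{G_𝒦}` is irreducible; (d) there exists `q ∣ N` that does not split in `𝒦`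
and such that `ρ̄_𝐟` is ramified at `q`; (e) the CM eigenform `g_ξ` associated to the character `ξ`
satisfies (dist) and (irred); (f) For each non-split prime `v` of `ℚ` we have that
`ε(π_{f,v}, ξ_v, ½) = 1` …; (g) Suppose the conductor of `ξ` is only divisible by primes split in `𝒦/ℚ`.
Then `𝓛^{Hida}_{𝐟,ξ,𝒦} ∈ 𝕀̂^{ur}[[Γ_𝒦]]` and `(𝓛^{Hida}_{𝐟,ξ,𝒦}) ⊇ char_{𝕀̂^{ur}[[Γ_𝒦]]}(X_{𝐟,𝒦,ξ})` as ideals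
of `𝕀̂^{ur}[[Γ_𝒦]]`. Here char means the characteristic ideal."

**Theorem 1.2** (l.90–102, VERBATIM). "We also have a two variable theorem for a single form. THEOREM
1.2. Let `N`, `f = f₀`, `κ` and `ξ` be as before. If (a) `p ≥ 5`; (b) the `p`-adic avatar of
`ξ|·|^{κ/2}(ω⁻¹ ∘ Nm)` factors through `Γ_𝒦` and `κ ≡ 0 (mod 2(p−1))`; (c) `ρ̄_f|_{G_𝒦}` is irreducible;
(d) there exists `q ∥ N` that does not split in `𝒦`. Then `(𝓛_{f,ξ,𝒦}) ⊇ char_{𝒪̂^{ur}_L[[Γ_𝒦]] ⊗_{𝒪_L} L}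
(X_{f,𝒦,ξ})` is true as fractional ideals of `𝒪̂^{ur}_L[[Γ_𝒦]] ⊗_{𝒪_L} L`." Followed by (l.103–112):
"Unlike the previous theorem, in this theorem we allow both global root numbers `+1` and `−1` cases. In
particular Theorem 1.2 is not deduced as a consequence of Theorem 1.1 … Hida's `p`-adic `L`-functions
`𝓛^{Hida}_{𝐟,ξ,𝒦}` are more canonical than the `𝓛_{𝐟,ξ,𝒦}` in that there is a constant in `ℚ̄_p^×` showing
up in our interpolation formula (see Proposition 7.7) … in the setting of Theorem 1.2 we do not know if
`𝓛_{f₀,𝒦,ξ}` is actually in `𝒪̂^{ur}_L[[Γ_𝒦]]` … Hypothesis (b) of Theorem 1.2 means that `𝓛_{f,ξ,𝒦}` can be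
evaluated at the trivial character of `Γ_𝒦`, though it is not a point at which it interpolates classical
`L`-values. As a result, Theorem 1.2 has interesting applications for the usual Bloch–Kato Selmer group of
`f`." (l.117: "joint work of the author with Skinner and Jetchev that uses Theorem 1.2 to deduce the
`p`-adic part of the precise BSD formula in the rank one case [JSW]".)

THE SELMER GROUP (§2.2, l.222–235, VERBATIM): "`T_{𝐟,𝒦,ξ} := T_𝐟 ⊗̂_{ℤ_p} Λ_𝒦` with the `G_𝒦` action
given by `ρ_𝐟 σ_{ξ^{−c}} ε^{(4−κ)/2} ⊗̂ Λ_𝒦(Ψ_𝒦^{−c})` … `Sel_{𝐟,𝒦,ξ} := ker{H¹(𝒦, T ⊗ 𝕀[[Γ_𝒦]]^*) →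
H¹(I_{v̄₀}, T ⊗ 𝕀[[Γ_𝒦]]^*) × ∏_{v ∤ p} H¹(I_v, T ⊗ 𝕀[[Γ_𝒦]]^*)}` … `X_{𝐟,𝒦,ξ} := (Sel_{𝐟,𝒦,ξ})^*` …
finitely generated `𝕀[[Γ_𝒦]]`-modules … We take the extension of scalars of them to `𝕀̂^{ur}[[Γ_𝒦]]`" —
i.e. NO condition above `v₀`, UNRAMIFIED above `v̄₀` and at every `v ∤ p`; "We can also replace `𝐟` with
a single form `f₀`" (Conj. 2.3). Prop. 2.4 (§2.3, l.252–256, used in the proof of Thm. 1.2): "Suppose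
`ρ̄_f|_{G_𝒦}` is absolutely irreducible. There is an exact sequence of `𝒪_L[[Γ_𝒦]]`-modules
`M → X^Σ_{𝐟}/℘X^Σ_{𝐟} → X^Σ_{f₀} → 0` where `M ⊗ L` has support of codimension at least `2`".

THE `L`-FUNCTIONS (§7.5). **Prop. 7.7** (l.1760–1779): "There is an element `𝓛^Σ_{𝐟,ξ,𝒦}` in
`𝕀̂^{ur}[[Γ_𝒦]]`, and a `p`-integral element `C^Σ_{𝐟,ξ,𝒦} ∈ ℚ̄_p^×` such that for any generic arithmetic
point `φ` of conductor `p^t`, we have `φ(𝓛^Σ_{𝐟,ξ,𝒦}/Ω_p^{2κ}) = C^Σ_{𝐟,ξ,𝒦} · [2πi p^{(κ−3)t} ξ_{1,p}²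
χ_{1,p}⁻¹χ_{2,p}⁻¹(p^{−t}) 𝔤(ξ_{v₀}χ_{1,p}⁻¹) 𝔤(ξ_{v₀}χ_{2,p}⁻¹) L^Σ(𝒦, π_{f_φ}, χ̄_φξ_φ, κ/2 − ½) (κ−1)!(κ−2)!]
/ Ω_∞^{2κ}`. Here `χ_{1,p}, χ_{2,p}` is such that … `π_{f_φ} ≃ π(χ_{1,p}, χ_{2,p})` with `val_p(χ_{1,p}(p)) =
−½`, `val(χ_{2,p}(p)) = ½` … The above interpolation formula can be written in terms of local
`ε`-factors by [the same with `2πi ε_p(3/2 − κ/2, ξ_{v₀}⁻¹χ_{1,p}) ε_p(3/2 − κ/2, ξ_{v₀}⁻¹χ_{2,p})` in place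
of the Gauss sums]" [← the tame-character display: GAUSS SUMS / local `ε`-FACTORS of the tamely ramified
`ξ_{v₀}`, where the crystalline frames of the tree (`IsHidaRankinLFunctionII`, `IsGreenbergLFunctionAnyRoot₂`)
carry the Euler factor `𝓔(ψ,f,1)`]. **Def. 7.8** (l.1804–1843): "Hida's `p`-adic `L`-function
`𝓛^{Hida}_{𝐟,ξ,𝒦} ∈ Λ_𝐃` … the `p`-adic `L`-function `𝒟` constructed in [Hida91, Thm. I] choosing `𝐟` there
to be the `g_{𝛏′}` and `𝐠^ρ` there to be the ordinary eigenforms of our `𝐟` … We multiply Hida's `p`-adic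
`L`-function `𝒟` by `2i^{2κ} Cl_𝒦 D_𝒦^{−1/2} · 𝓛^{Katz}_{𝒦,ξ}` … We denote this result as `𝓛^{Hida}_{𝐟,ξ,𝒦}`.
One checks readily the interpolation formula for it is `φ(𝓛^{Hida}/Ω_p^{2κ}) = [2πi ε_p(…)ε_p(…)
L(𝒦, π_{f_φ}, χ̄_φξ_φ, κ/2 − ½)(κ−1)!(κ−2)!]/Ω_∞^{2κ}` … By the main conjecture proved in [HT93], [HT94] and
[Hida06] … the `Cl_𝒦 · 𝓛^{Katz}_{𝒦,ξ}` generates the congruence module for `𝐠` and our `𝓛^{Hida}` is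
integral"; (l.1847–1852) "`𝓛^Σ_{f₀,ξ,𝒦}` for the specialization of `𝓛^Σ_{𝐟,ξ,𝒦}` to `𝒪̂^{ur}_L[[Γ_𝒦]]` at `f₀`
… interpolation formula (10) … for `ξ_φ`'s of conductor `(p^t, p^t)` at `p`."
THE ANTICYCLOTOMIC RESTRICTION (§7.5, "Anti-cyclotomic `μ`-invariants", l.1855–1859, VERBATIM): "Now
assume we are under assumption of Theorem 1.1 … Consider the one-dimensional subspace of
`Spec 𝕀̂^{ur}[[Γ_𝒦]]` of anti-cyclotomic twists by characters of order and conductor powers of `p` that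
passes through `φ₀`. We look at the ratio between the specialization of Hida's `p`-adic `L`-function
`𝓛^{Hida}_{𝐟,ξ,𝒦}` to this subspace and the anti-cyclotomic `p`-adic `L`-function considered by [Hsi12]
[= Hsieh, Doc. Math. 19 (2014) 709–767] (note that the local sign assumptions there are satisfied) … The
remaining factors are: the `C(π,λ)` and `𝔉` in [Hsi12] which is a fixed `p`-adic unit, and the powers of
`Im(δ)` and `2` which are unit Iwasawa elements. So by result proved in [Hsi12] the anti-cyclotomic
`p`-adic `L`-function has `μ`-invariant `0`."
PROOF OF THM. 1.2 (§9, l.2753–2755): "assume we are under the assumption of Theorem 1.2. Note that in this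
case `𝓛_{χξ̄′} = 1` … there is a number `a` such that `(𝓛^Σ_{𝐟,𝒦,ξ}) ⊇ (P₁⋯P_t)^a Fitt(X^Σ)` … Specialize
to `φ₀′`, using Proposition 2.4, we find `(𝓛^Σ_{f₀,𝒦,ξ}) ⊇ Fitt_{𝒪̂^{ur}_L[[Γ_𝒦]] ⊗ L}(X_{f₀})`."

## Transcription of Theorem 1.2 (the one named fact) — E-currency, and why that IS the printed reading

(E) THE INSTANCE. `f` is the newform of an elliptic curve `E/ℚ` (globally minimal model `W`, `IsNewformOf
W f`, level `N = N_E`), so `L = ℚ_p`, `𝒪̂_L^{ur} = ℤ_p^{ur} ⊂ 𝒪_{ℂ_p}`. "Square-free tame level `N` … `f`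
the ordinary stabilization of a new form of level `N`" ↦ `Squarefree N`, `p ∤ N`, `GoodOrd W p` (good
ORDINARY at `p`: the weight-2 member of a Hida family). (a) ↦ `5 ≤ p`. (c) ↦ every `𝔽_p`-framing of
`E[p]|_{G_𝒦}` is ABSOLUTELY irreducible — READING FLAG `Wan20-1.2c`: print (c) says "irreducible", but
Prop. 2.4, invoked in the printed proof of Thm. 1.2, says "absolutely irreducible"; the binder asks the
stronger hypothesis, so the fact is WEAKER than print, never stronger (same spelling as
`YanZhu2026.thm42_…`, `BurungaleSkinnerTianWan2024.thm924_…_OPEN`). (d) ↦ `∃ q` prime, `q ∣ N`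
(`q ∥ N` is automatic, `N` square-free), `q` not split in `𝒦` (`#primesOver q ≠ 2`, i.e. inert OR
RAMIFIED — the cell's "Wan prime" is ramified). Setting ↦ `𝒦` imaginary quadratic, two primes over `p`,
`v₀ ≠ v̄₀` above `p`, `v₀` "determined by `ι`" (`k ∈ v₀ ↔ ‖ι⁻¹ k‖ < 1`, the clause of every BDP/Katz fact
of the tree). NOT assumed (faithful to print): `(N, D_𝒦) = 1`, any Heegner hypothesis, "`2` splits".
(E-b) HYPOTHESIS (b) AND THE BRANCH CHARACTER `ξ`. In E-currency `ξ` is NOT a parameter: (b) says exactly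
that the `Γ_𝒦`-family `𝛏 = ξ · Ψ_𝒦` passes through the twist making `T_{f,𝒦,ξ}` the cyclotomic-type
deformation of `ρ_f` itself ("can be evaluated at the trivial character … the usual Bloch–Kato Selmer group
of `f`", l.112), so that — after re-centring `Λ_𝒦` by the `Γ_𝒦`-character through which that avatar
factors — `X_{f,𝒦,ξ}` is the Greenberg Selmer dual of `T_pE ⊗ Λ_𝒦(Ψ^{−1})` over the `ℤ_p²`-tower with NO
condition above `v₀` and the UNRAMIFIED condition above `v̄₀` and away from `p`: the tree's
`WeierstrassCurve.XGr₂ (W.baseChange 𝒦) p κ₁ κ₂ v̄₀ γ₁ γ₂` (`unrSelmer₂ … v̄₀`: "unramified at every place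
not above `p` and above `v̄`, no condition above the other prime", `Rubin1991/TwoVariableMainConjecture.lean`;
the reading `YZ-2VAR-Gr-str-is-unr` of the sibling typers). This E-currency reading is PRINTED by the
authors themselves: Jetchev–Skinner–Wan, Camb. J. Math. 5 (2017), Thm. 6.1.4 (= arXiv:1512.06894 Thm. 34:
"([wan:rankin], [wan:rankin-ss]) Suppose (irr_𝒦), (split), (gen-H), (good), and (□-free) hold. Suppose also
that there is at least one prime divisor of `N` non-split in `𝒦` and that `Σ` contains all places dividing
`N D_𝒦`. Then `char_{Λ_𝒦}(X_Gr^Σ(𝓜)) Λ_{𝒦,R}[1/p] ⊆ (𝓛_p^Σ(f))`" for `𝓜 = T ⊗ Λ_𝒦(Ψ⁻¹)`, `T = T_pE` when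
`A_f = E`), and is the object of Wan's own §2.3/§9 (`φ₀` = "`γ^± ↦ 1`, `f₀`").
(L) THE `L`-FUNCTION. Print: `𝓛_{f,ξ,𝒦} = C · u · 𝓛^{Hida}_{f,ξ,𝒦}` with `C ∈ ℚ̄_p^×` `p`-integral and `u`
a unit ("the ratio … consists of the `p`-integral number `C^Σ` … [and] prime to `p` root numbers which are
`p`-units and move `p`-adic analytically", Def. 7.8 / l.106), and `𝓛^{Hida}` = Hida's two-variable Rankin
measure `𝒟` [Hida91] × `Cl_𝒦 · 𝓛^{Katz}` (Def. 7.8) = Jetchev–Skinner–Wan's `𝓛_p(f) = (h_𝒦/w_𝒦 ·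
L_p⁻(𝒦) ⊗ 1) · D` (CJM §5.2) = Castella–Grossi–Skinner's `𝓛_p^Gr(f/K) := h_K · 𝓛_v(K)⁻ · 𝓛_p(f/K, Σ^{(2′)})`
(Math. Ann. 393, Def. 2.4.3) — the object the tree ALREADY carries as "a Katz frame `LK`
(`IsKatzMeasure₂ ι v₀ v̄₀ ∅ κ₁ κ₂ γ₁⁻¹ γ₂⁻¹ 1 Ω δ Ω_p LK`) and a Greenberg value frame `G` over it
(`IsGreenbergLFunctionAnyRoot₂ ι v₀ v̄₀ κ₁ κ₂ γ₁⁻¹ γ₂⁻¹ f |D_𝒦| h_𝒦 LK G`)", VERBATIM the `L`-side binder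
block of `YanZhu2026.thm42_XGr₂_isTorsion_charIdeal_le_greenbergAnyRoot`,
`BurungaleCastellaSkinner2025.proofProp422_span_minus_eq_span_bdp_goodReduction` and
`BurungaleSkinnerTianWan2024.thm924_greenberg_dvd_charIdealXGr₂_awayFromCyc_OPEN` (whose printed proof is
"the ordinary case goes back to [W1]" = this theorem). READING FLAG `Wan20-L-is-LpGr`: the identification
`(𝓛_{f,ξ,𝒦}) ⊗ ℚ = (𝓛_p^Gr) ⊗ ℚ` is Jetchev–Skinner–Wan's §5.2 + Thm. 6.1.4 and CGS Def. 2.4.3, not a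
sentence of Wan 2020; because Thm. 1.2 is RATIONAL, the unspecified constant `C ∈ ℚ̄_p^×` and all period /
unit normalisations (flags `CGS-241-level`, `YZ-39-petersson`, `BSTW-924-conjugate-convention` of the frame's
home files) are invisible in the typed conclusion. The frames are universally quantified (print's
`𝓛` is pinned by its values on the Zariski-dense type-II range given `LK`; where no frame exists the clause
is vacuous, never false).
(C) THE CONCLUSION "`(𝓛_{f,ξ,𝒦}) ⊇ char(X_{f,𝒦,ξ})` as fractional ideals of `𝒪̂^{ur}[[Γ_𝒦]] ⊗ L`" ↦ for
every structure-compatible `J : ℤ_p → 𝒪_{ℂ_p}` there is `k` with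
`p^k · char_{Λ_𝒦}(XGr₂ … v̄₀) 𝒪_{ℂ_p}⟦T₁,T₂⟧ ⊆ (G)` (`char` is finitely generated, so "after `⊗ L`" = "after a
power of `p`"; `Λ^{ur} → 𝒪_{ℂ_p}` along `toUnr₂ p J`, faithfully flat on ideals of valuation rings — the
device (T1) of `YanZhu2026/GreenbergMainTheorems.lean`; WEAKER than `Λ^{ur}`-rationality). The tower is
presented, as in every two-variable fact of the tree, by THE cyclotomic / anticyclotomic pair `(κ₁, κ₂)`
with an adapted generator pair `(γ₁, γ₂)` (`Γ_𝒦 = Γ⁺ × Γ⁻`, print §2 l.188; the frames are written in these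
coordinates at the inverse generators, convention (T2) loc. cit.). No torsion claim (print makes none;
`char := 0` for non-torsion modules, l.220, and then the inclusion is empty of content — as in print).
The conclusion implies the "away from the cyclotomic line" shape of
`BurungaleSkinnerTianWan2024.thm924_greenberg_dvd_charIdealXGr₂_awayFromCyc_OPEN` (whose printed proof is "the
ordinary case goes back to [W1]" = this theorem) with the constant witness `s = p^k` — a two-line unfolding,
elaborated in the seat's folder against that binder's exact hypothesis block, not shipped (statement-only file).
(Σ) Print Thm. 1.2 is the FULL (all Euler factors in) statement; its proof reduces to the `Σ`-primitive one
(l.2744, [GV, Prop. 2.4]); Jetchev–Skinner–Wan print the `Σ ⊇ {w ∣ N D_𝒦}` form. Typed: `Σ = ∅` (the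
tree's `XGr₂` has no `Σ`), citing Thm. 1.2 itself.

## The additive ("tame") reading asked for by LeadReport12 §4 — what print does NOT give (referee note)

The crux stub `ThreeFieldRoad.stub_tameGreenbergInclusionR0` wants the conclusion (C) for `E = V ⊗ χ_{p*}`
ADDITIVE at `p` (`V` good ordinary, `f = f_V`, `E[p^∞]|_{G_𝒦} = V[p^∞] ⊗ ξ₀`, `ξ₀ := χ_{p*} ∘ N_{𝒦/ℚ}`
quadratic of conductor `(p) = v₀v̄₀`), i.e. Wan's `X_{f_V,𝒦,ξ′}` for a branch character `ξ′` in the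
`Γ_𝒦`-class SHIFTED BY `ξ₀` from the class of hypothesis (b). The standing slot `ord_{v₀}(cond ξ_{v₀}) ≤ 1`
and Thm. 1.1 (b) `ξ|_{𝔸_ℚ^×} = ω ∘ Nm` admit both classes (`ξ₀|_{𝔸_ℚ^×} = χ_{p*}² = 1`; `ξ′_{v₀}|_{μ_{p−1}}`
stays non-trivial tame for `p ≥ 5`), but Thm. 1.2 (b) holds for AT MOST ONE of `ξ`, `ξ·ξ₀` (`ξ₀` does not
factor through the pro-`p` group `Γ_𝒦`: its restriction to `μ_{p−1} ⊂ 𝒪_{v₀}^×` is the quadratic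
character). HENCE THE TAME INSTANCE IS NOT AN INSTANCE OF PRINT THEOREM 1.2 (= v1 Thm. 1.1 (2)), and this
file does not vendor it. In print only THEOREM 1.1 (three variables, Hida family through `f_V`, Hida's
INTEGRAL `𝓛^{Hida}_{𝐟,ξ′,𝒦}`, extra hypotheses (d) `ρ̄` ramified at `q`, (e) `g_{ξ′}` (dist)+(irred), (f) local
root numbers `+1` at the non-split primes, (g) `cond ξ′` supported on split primes — `p` is split) speaks
about the shifted class, over `𝕀̂^{ur}[[Γ_𝒦]]`; the descent `𝕀 → 𝒪` at `f_V` of the characteristic ideal is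
performed in print only inside the proof of Thm. 1.2 (l.2753–2755: localise at the height-one primes
pulled back from `𝕀`, Prop. 2.4) — a port, not a citation. Observation for the pen (NOT vendored, not a
claim of this file): in the printed proof of Thm. 1.2 hypothesis (b) is visibly used through
"`𝓛_{χξ̄′} = 1`" (l.2753), a consequence of `ξ|_{𝔸_ℚ^×} = ω ∘ Nm` and `2(p−1) ∣ κ` shared by both classes;
whether the class condition in (b) is needed for the THEOREM (as opposed to its evaluation at the trivial
character, l.112) is a question for the author, not for the tree. What the tree needs for the tame road is
therefore EITHER a typed three-variable Thm. 1.1 (requires `𝕀`-adic families: GAP) plus the `𝕀 → 𝒪`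
specialisation of characteristic ideals, OR a printed two-variable statement with a FREE branch-character
slot. THE LATTER EXISTS IN REFEREED PRINT (found by this seat's presearch; not Wan 2020, hence NOT typed in
this file): Castella–Liu–Wan, *Iwasawa–Greenberg main conjecture for nonordinary modular forms and
Eisenstein congruences on GU(3,1)*, Forum Math. Sigma 10 (2022) e110 (bib key `CastellaLiuWan2022`;
arXiv:2109.08375v1, TeX fetched): for `π` generated by a weight-2 newform with `π_v` unramified, Steinberg
or unramified-quadratic-twisted Steinberg at every finite `v`, `π_p` UNRAMIFIED (ordinary or not), a
non-split `q` with `π_q` ramified (and `π₂` ramified if `2` is non-split), `ρ̄_π|_{G_𝒦}` irreducible (§4.1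
"Our setup", l.3291–3305), and ANY algebraic Hecke character `ξ` of ∞-type `(0, k₀)`, `k₀` even — with
`X_{π,𝒦,ξ}` = the dual of the Selmer group of `T_π(ε²)|_{G_𝒦}(ξ⁻¹) ⊗ ℤ_p⟦Γ_𝒦⟧(Ψ_𝒦⁻¹)` "relaxed at `𝔭` and
unramified at `𝔭̄`" (l.1786–1797) and `𝓛_{π,𝒦,ξ} ∈ Frac(𝒪̂^{ur}⟦Γ_𝒦⟧)` interpolating
`(Ω_p/Ω_∞)^{2(k₂−k₁)} Γ(k₂)Γ(k₂−1)/(2πi)^{2k₂−1} · γ_p((3−(k₁+k₂))/2, π_p^∨ × (ξ₀τ₀)⁻¹_𝔭̄) ·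
L^{{∞,p}}((k₁+k₂−1)/2, BC(π) × ξ₀τ₀)` at `τ` through `Γ_𝒦` with `ξτ` of type `(k₁, k₂)`, `k₁ ≤ 0`,
`k₂ ≥ 2 − k₁` (display `eq:intp`, l.1809–1817: the LOCAL GAMMA FACTOR at `p` — Gauss sums when `ξ` is
tamely ramified at `p` — is exactly the "tame-character display" LeadReport12 §4 asks a typer to build) —
its main theorem (`thm:main`, arXiv v1 Thm. 8.2.1; l.5757–5781) states: "(1) As fractional ideals of
`𝔓ℛ = 𝒪^{ur}_L⟦Γ_𝒦⟧ ⊗_{𝒪_L⟦Γ_𝒦⁺⟧} Frac(𝒪_L⟦Γ_𝒦⁺⟧)`, `(𝓛_{π,𝒦,ξ}) ⊇ char_𝔓ℛ(X_{π,𝒦,ξ} ⊗ 𝔓ℛ)` [NO condition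
on the class of `ξ`; away from the CYCLOTOMIC variable — the shape of the tree's
`BurungaleSkinnerTianWan2024.thm924_…_awayFromCyc_OPEN`]; (2) If `ξ_𝔭 ≢ ξ_𝔭̄` modulo the maximal ideal of
`𝒪_L`, then `𝓛_{π,𝒦,ξ} ∈ 𝒪^{ur}_L⟦Γ_𝒦⟧` and if it further satisfies: `ξ|_{𝔸_ℚ^×} = ω²` … and
`k₀ ≡ 0 mod 2(p−1)`; for every finite place of `ℚ` non-split in `𝒦`, `ε_v(½, BC(π) × ξ₀) = 1`; the
conductor of `ξ` is only divisible by primes split in `𝒦/ℚ`, then `(𝓛_{π,𝒦,ξ}) ⊇ char_{𝒪^{ur}⟦Γ_𝒦⟧ ⊗ ℚ}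
(X_{π,𝒦,ξ} ⊗ ℚ)`" [RATIONAL, no localisation, NO class condition of the kind of Wan's Thm. 1.2 (b)]. For
`E = V ⊗ χ_{p*}`: `π = π_{f_V}`, `ξ ≡ ε·(χ_{p*}∘Nm)·(Γ_𝒦-character)` puts `T_π(ε²)(ξ⁻¹) ⊗ Λ(Ψ⁻¹)` on
`T_pE ⊗ Λ_𝒦(Ψ⁻¹)` (CLW: "geometric convention … det ρ_π = ε⁻¹", l.1776, so `T_π(ε²) = T_pV(1)`), and part
(2)'s residual condition `ξ_𝔭 ≢ ξ_𝔭̄` and sign/conductor conditions are then conditions on the auxiliary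
`∞`-type and on `(V, 𝒦, q)` to be checked by the pen. RECOMMENDED next typer unit: `CastellaLiuWan2022/`
(Thm. 8.2.1 with the branch character as a PARAMETER needs (i) a twisted two-variable Greenberg dual
`XGr₂` of `E[p^∞] ⊗ χ` — the tree's `XGr₂` is the untwisted curve's — or the E-instance above, and (ii) the
`γ_p`-factor value frame; both are vocabulary, not mathematics).

## NOT typed here (GAPS, precise)
* Print Thm. 1.1 and Conj. 2.2 (three variables): no `𝕀`-adic Hida family / `𝕀̂^{ur}[[Γ_𝒦]]`-module in the
  tree (`HidaFamilyMembers.lean` is member-wise).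
* Wan's own interpolation displays (Prop. 7.7 (8)/(91), Def. 7.8 (9), (10)): "generic arithmetic points of
  conductor `p^t`" (Def. 6.? `definegeneric`), the unitary parameters `χ_{1,p}, χ_{2,p}`, `ε_p(s, λ)` of
  l.1770, the CM periods `(Ω_∞, Ω_p)` of [Hsieh CM] and the constant `C^Σ` are not pinned by tree vocabulary;
  a value frame with a guessed normalisation would be worse than none (cf. the (D1)/(D2) corrections of
  `YanZhu2026/GreenbergMainTheorems.lean`). The Gauss-sum display is QUOTED above for the pen.
* The anticyclotomic-restriction sentence (§7.5) is about the three-variable `𝓛^{Hida}` under Thm. 1.1's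
  hypotheses; its E-currency shadow at a good prime — "`(G⁻) = (L_p^{BDP})` in `Λ^{−,ur}`" — is ALREADY in the
  tree: `BurungaleCastellaSkinner2025.proofProp422_span_minus_eq_span_bdp_goodReduction` (refereed, needs
  (Heeg)), `YanZhu2026.prop314_span_minus_eq_span_bdp_anyRoot` (refereed, Heegner hypothesis); NOT restated.
  Note both require every `ℓ ∣ N` SPLIT in `𝒦`, incompatible with Thm. 1.2 (d); the `q`-RAMIFIED comparison
  is Jetchev–Skinner–Wan Cor. 5.3.? (arXiv Cor. 29, "`(L_p^Σ(f)) = (𝓛_p^Σ(f)⁻)` in `Λ_R[1/p]`", `Σ` large) —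
  not in the tree, not typed here (its `L_p(f)` carrier under (gen-H) with ramified primes is not pinned).

## References
* [Wan2020RankinSelbergIMC] X. Wan, Algebra & Number Theory 14:2 (2020) 383–483, doi
  10.2140/ant.2020.14.383 = arXiv:1408.4044v5: §1 Thm. 1.1 (TeX l.74–89), Thm. 1.2 (l.91–102), l.103–112;
  §2.2 (l.211–248), Prop. 2.4 (l.252–285); §7.5 Prop. 7.7 (l.1760–1779), Def. 7.8 (l.1804–1843), l.1847–1859;
  §9 (l.2743–2756). Store text `paper:arxiv-1408.4044` = v1 [corpus: p0003–p0004 (v1 Thm. 1.1), p0011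
  (Selmer groups), p0029–p0030 (L-functions, μ)].
* [JetchevSkinnerWan2017] D. Jetchev, C. Skinner, X. Wan, Camb. J. Math. 5 (2017) 369–434 = arXiv:1512.06894:
  §2.3.3 (the structure `𝓕_Gr`, [corpus: paper:arxiv-1512.06894 p0007 L126–p0008 L18]), §5.2 (`𝓛_p(f)`,
  p0023 L60–p0024 L86), §5.3 Cor. 5.3.? (arXiv Cor. 29, p0025), Thm. 6.1.4 (arXiv Thm. 34, p0026 L53–L63).
* [CastellaGrossiSkinner2025] Math. Ann. 393 (2025), Thm. 2.4.1, Def. 2.4.3 (the frame's home: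
  `CastellaGrossiSkinner2025/TwoVariablePAdicLFunctionII.lean`, `YanZhu2026/GreenbergMainTheorems*.lean`).
* [BurungaleCastellaSkinner2025] IMRN 2025, Conj. 4.1.2 / Prop. 4.2.2 (`L_p^Gr(g/K)`; tree files cited above).
* [Hsieh2014] = Wan's [Hsi12], M.-L. Hsieh, Doc. Math. 19 (2014) 709–767 (tree: `IsHsiehLFunction`, `Hsieh2014/`).
-/

noncomputable section

open scoped Classical

open PowerSeries NumberField IsDedekindDomain Field CongruenceSubgroup
  Literature.NumberTheory.GaloisRepresentations Literature.NumberTheory.EllipticCurves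
  Literature.NumberTheory.EllipticCurves.ModularForms Literature.NumberTheory.EllipticCurves.Rank1Residual

namespace Literature.NumberTheory.EllipticCurves.Wan2020

open IwasawaAlgebra₂

/-- **X. Wan, ANT 14 (2020), Theorem 1.2** (§1, TeX l.91–102 of the accepted manuscript arXiv:1408.4044v5;
= Theorem 1.1 (2) of arXiv v1 = the store text) — **the rational two-variable Greenberg divisibility
`(𝓛_{f,ξ,𝒦}) ⊇ char(X_{f,𝒦,ξ}) ⊗ L` over the `ℤ_p²`-extension of `𝒦`**, read on an elliptic curve (the
reading printed by Jetchev–Skinner–Wan, CJM 5 (2017) Thm. 6.1.4 = arXiv Thm. 34; module docstring (E),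
(E-b), (L), (C), (Σ)). PRINT: "Let `N`, `f = f₀`, `κ` and `ξ` be as before [`N` square-free, `f` of weight
two and trivial nebentypus, the ordinary stabilization of a new form of level `N`, in a Hida family new
outside `p`; `𝒦` imaginary quadratic, `p = v₀v̄₀` split, `v₀` determined by `ι`; `ξ` of infinity type
`(κ/2, −κ/2)`, `κ ≥ 6` even, `ord_{v₀}(cond ξ_{v₀}) ≤ 1`, `ord_{v̄₀}(cond ξ_{v̄₀}) ≤ 1`]. If (a) `p ≥ 5`;
(b) the `p`-adic avatar of `ξ|·|^{κ/2}(ω⁻¹∘Nm)` factors through `Γ_𝒦` and `κ ≡ 0 (mod 2(p−1))`;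
(c) `ρ̄_f|_{G_𝒦}` is irreducible; (d) there exists `q ∥ N` that does not split in `𝒦`. Then
`(𝓛_{f,ξ,𝒦}) ⊇ char_{𝒪̂^{ur}_L[[Γ_𝒦]] ⊗ L}(X_{f,𝒦,ξ})` is true as fractional ideals of `𝒪̂^{ur}_L[[Γ_𝒦]] ⊗ L`."
TRANSCRIBED: `E = W/ℚ` elliptic, globally minimal, with newform `f` of level `N = N_E`; `Squarefree N`;
`5 ≤ p`, `p ∤ N`, `GoodOrd W p`; `𝒦` imaginary quadratic, two primes over `p`, `v₀ ≠ v̄₀` above `p`, `v₀`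
induced by `ι`; (c) as ABSOLUTE irreducibility of every `𝔽_p`-framing of `E[p]|_{G_𝒦}` (flag `Wan20-1.2c`,
WEAKER than print); (d) a prime `q ∣ N` with `#primesOver q ≠ 2`; (b) is absorbed by the E-currency (the
Selmer group IS the one of `T_pE ⊗ Λ_𝒦(Ψ⁻¹)`, flag `Wan20-1.2b-class`); the tower in (cyclotomic,
anticyclotomic) coordinates `(κ₁, κ₂; γ₁, γ₂)`; `X_{f,𝒦,ξ}` ↦ `(W.baseChange 𝒦).XGr₂ p κ₁ κ₂ v̄₀ γ₁ γ₂` (no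
condition above `v₀`, unramified above `v̄₀` and away from `p` — print §2.2 verbatim); `𝓛_{f,ξ,𝒦} ⊗ ℚ`
↦ every Katz frame `LK` with genuine period data and every Greenberg value frame `G` over it (flag
`Wan20-L-is-LpGr`: `= 𝓛^{Hida} = 𝓛_p^Gr` up to `ℚ̄_p^×`, JSW §5.2 / CGS Def. 2.4.3). CONCLUSION: along every
structure-compatible `J : ℤ_p → 𝒪_{ℂ_p}` there is `k : ℕ` with
`(p^k) · char_{Λ_𝒦}(X_Gr) 𝒪_{ℂ_p}⟦T₁,T₂⟧ ⊆ (G)`. Faithful to print: no `(N, D_𝒦) = 1`, no Heegner hypothesis,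
no "`2` splits", no torsion claim. NOT an instance: the additive curve `E = V ⊗ χ_{p*}` of the cell's tame
road (module docstring, "what print does NOT give"). PUBLISHED (ANT 2020; E-reading: CJM 2017).
[cite: Wan2020RankinSelbergIMC, Thm. 1.2 (§1; arXiv:1408.4044v5 TeX l.91–102; = arXiv v1 Thm. 1.1 (2), paper:arxiv-1408.4044 p0004), with the setting §1 l.58, the Selmer group §2.2 l.222–235, Prop. 2.4, and Def. 7.8 / l.1847–1852 (𝓛_{f₀,ξ,𝒦}, 𝓛^{Hida})]
[cite: JetchevSkinnerWan2017, Thm. 6.1.4 (= arXiv:1512.06894 Thm. 34, paper:arxiv-1512.06894 p0026 L53–L63) and §5.2 (𝓛_p(f), p0024 L60–L86), §2.3.3 (𝓕_Gr)]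
[cite: CastellaGrossiSkinner2025, Def. 2.4.3 with Thm. 2.4.1 (the frame `IsGreenbergLFunctionAnyRoot₂` / `IsKatzMeasure₂` = `𝓛_p^Gr = h_K·𝓛_v(K)⁻·𝓛_p(f/K,Σ^{(2′)})`)] -/
def thm12_XGr₂_charIdeal_le_greenberg_rat : Prop :=
  ∀ {p : ℕ} [Fact p.Prime] (ι : PadicAlgCl p ≃+* ℂ) (W : WeierstrassCurve ℚ) [W.IsElliptic]
    [W.IsGloballyMinimal] (K : Type) [Field K] [NumberField K] (v vbar : HeightOneSpectrum (𝓞 K))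
    (κ₁ κ₂ : ZpExtension K p) (γ₁ γ₂ : absoluteGaloisGroup K)
    [Fact (ZpExtension.IsTopGeneratorPair κ₁ κ₂ γ₁ γ₂)] {N : ℕ} [NeZero N] {f : CuspForm (Gamma0 N) 2}
    (_ : IsNewformOf W f) [NeZero (NumberField.discr K).natAbs],
    -- `f = f_E` of level `N = N_E`, `N` square-free (square-free tame level `N`, `f` new of level `N`)
    (N : ℤ) = W.conductorNorm ℤ → Squarefree N →
    -- (a) `p ≥ 5`; `f` is the weight-two member of a Hida family: `p ∤ N`, good ORDINARY at `p`
    5 ≤ p → ¬ p ∣ N → GoodOrd W p →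
    -- setting: `𝒦` imaginary quadratic, `p = v₀ v̄₀` split, `v₀` (= `v`) determined by `ι`
    IsImaginaryQuadratic K → ((Ideal.span {(p : ℤ)}).primesOver (𝓞 K)).ncard = 2 →
    ((p : ℕ) : 𝓞 K) ∈ v.asIdeal → ((p : ℕ) : 𝓞 K) ∈ vbar.asIdeal → vbar ≠ v →
    (∀ (w : InfinitePlace K) (k : 𝓞 K), k ∈ v.asIdeal ↔ ‖ι.symm (w.embedding (k : K))‖ < 1) →
    -- (c) `ρ̄_f|_{G_𝒦}` (absolutely) irreducible — flag `Wan20-1.2c`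
    (∀ ρ : ModPGaloisRep K (ZMod p) 2, (W.baseChange K).IsTorsionGaloisRep p ρ →
      FramedRep.IsAbsolutelyIrreducible ρ) →
    -- (d) some prime `q ∣ N` (so `q ∥ N`) does not split in `𝒦` (inert or ramified)
    (∃ q : ℕ, q.Prime ∧ q ∣ N ∧ ((Ideal.span {(q : ℤ)}).primesOver (𝓞 K)).ncard ≠ 2) →
    -- the `ℤ_p²`-tower in (cyclotomic, anticyclotomic) coordinates
    κ₁.IsCyclotomic → κ₂.IsAnticyclotomic →
    -- `𝓛_{f,ξ,𝒦} ⊗ ℚ`: every Katz frame with genuine period data and every Greenberg value frame over it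
    ∀ (Ω δ : ℂ) (Ωp : (unrIntegers p)ˣ) (LK G : PowerSeries (PowerSeries (PadicComplexInt p))),
      Ω ≠ 0 → (δ ^ 2 = (NumberField.discr K : ℂ) ∨ δ ^ 2 = -(NumberField.discr K : ℂ)) →
      IsKatzMeasure₂ ι v vbar ∅ κ₁ κ₂ γ₁⁻¹ γ₂⁻¹ 1 Ω δ ((Ωp : unrIntegers p) : ℂ_[p]) LK →
      IsGreenbergLFunctionAnyRoot₂ ι v vbar κ₁ κ₂ γ₁⁻¹ γ₂⁻¹ f (NumberField.discr K).natAbs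
        (NumberField.classNumber K) LK G →
    -- along every structure map `ℤ_p → 𝒪_{ℂ_p}` (the extension `char(X) Λ^{ur}` read in `𝒪_{ℂ_p}⟦T₁,T₂⟧`)
    ∀ J : ℤ_[p] →+* PadicComplexInt p,
      (∀ x : ℤ_[p], ((J x : PadicComplexInt p) : ℂ_[p]) = ((x : ℚ_[p]) : ℂ_[p])) →
    -- `(𝓛) ⊇ char(X_{f,𝒦,ξ})` as FRACTIONAL ideals: after a power of `p`
    ∃ k : ℕ,
      Ideal.span {PowerSeries.C (PowerSeries.C (((p : ℕ) : PadicComplexInt p) ^ k))} *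
          (WeierstrassCurve.XGr₂.charIdeal (W.baseChange K) p κ₁ κ₂ vbar γ₁ γ₂).map (toUnr₂ p J) ≤
        Ideal.span {G}

end Literature.NumberTheory.EllipticCurves.Wan2020

end
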